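import Summits.SmoothPoincare4.SmoothPoincare4.Theorems.CylinderEntropyCylinderRungTwoProductTestIdentity
import Summits.SmoothPoincare4.SmoothPoincare4.Theorems.CylinderEntropyCylinderRungTwoTiltExcess
import HarnessLib

/-!
# Route `CylinderEntropy`, crux `CylinderRungTwo` (stmt-SmoothPoincare4-7631), line `killing-flux`:
# single-slice bounds for the passage of the product-test identities to the weak limit
# (first half of the registered helper `helper_productTestLimit`, step S2 of the area-quantization plan)

For a closed immersed cross-section `f : M⁴ → N = S⁴ × ℝ = {z ∈ ℝ⁶ | ∑_{i<5} zᵢ² = 1}` with smooth unit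
normal `ν` tangent to `N`, heights `|z₅| ≤ B`, and test functions `Φ ∈ C²(ℝ)`, `P ∈ C²(ℝ⁵)`, the landed
product test identity (`productTest_identity`, `…ProductTestIdentity.lean`) reads
`∫_M (F ∘ f + R) dμ_g = 0` with `F(z) = Φ(z₅)·[Δ_{ℝ⁵}P(z') - D²P(z')(z',z') - 4DP(z')(z')]` and the
remainder `R = Φ''P(1 - ν₅²) - 2Φ'ν₅DP(ν') - ΦD²P(ν', ν') + |ν'|²ΦDP(z') - H(Φ'ν₅P + ΦDP(ν'))`.
Since `|ν'|² = 1 - ν₅²`, `|ν₅| ≤ 1`, `|z'| = 1` and `Φ, Φ', Φ'', P, DP, D²P` are bounded by `A₁`, `A₂`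
on the slab, `|R| ≤ A₁A₂(3(1 - ν₅²) + 2|ν'| + 2|H|)`, whence by Cauchy–Schwarz the SINGLE-SLICE
ESTIMATE `|∫ F ∘ f dμ_g| ≤ A₁A₂ (3 T + 2 √(μ_g(M) T) + 2 √(μ_g(M) ∫ H² dμ_g))`, `T = ∫ (1 - ν₅²) dμ_g`
the tilt excess (`abs_integral_productTest_comp_le`). The limit along an almost-stationary sequence is
taken in `…ProductTestLimit.lean`.

* `abs_productTestRemainder_le` — the pointwise bound on the remainder (`|ab| ≤ AB` bookkeeping);
* `norm_sq_eq_sum_castSucc_add_sq`, `norm_truncL_sq`, `norm_le_one_add_abs`,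
  `norm_normal_eq_one`, `sum_sq_castSucc_eq`, `norm_truncL_normal_sq`, `abs_normal_five_le_one`,
  `norm_truncL_normal_le_one` — coordinates of points of `N` and of unit normals;
* `exists_common_bound`, `continuous_deriv_deriv`, `continuous_fderiv_app`,
  `continuous_iteratedFDeriv_two_app` — compactness bounds and continuity bookkeeping;
* `abs_integral_productTest_comp_le` — the single-slice estimate; `helper_productTestLimit_part1` — the
  same with explicit binders (registered sub-goal, part 1/2 of `helper_productTestLimit`).

Everything here is PROVED (no `sorry`, no new definitions, no named facts).

References: R. S. Hamilton, Comm. Anal. Geom. 1 (1993) 127–137, §4 (first variation on slices of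
`S⁴ × ℝ`); W. K. Allard, *On the first variation of a varifold*, Ann. of Math. 95 (1972), §6.
-/

-- the prescribed namespace `Summit.SmoothPoincare4.SmoothPoincare4.…` repeats `SmoothPoincare4`
set_option linter.dupNamespace false

noncomputable section

open Set Function Filter MeasureTheory
open scoped Manifold ContDiff ENNReal NNReal Topology BigOperators RealInnerProductSpace
  BoundedContinuousFunction

namespace Summit.SmoothPoincare4.SmoothPoincare4.Cruxes.CylinderRungTwo.KillingFlux

open Literature.Geometry.Riemannian Literature.Geometry.Lorentzian
  Literature.Geometry.Lorentzian.PseudoRiemannianMetric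
open Literature.Geometry.Riemannian.SphericalCylinderEntropy (truncL truncL_apply)

/-! ## The pointwise bound on the remainder -/

section Pointwise

/-- **Pointwise bound on the remainder of the product test identity.** With `|Φ⁽ⁱ⁾| ≤ A₁`,
`|P|, ‖DP‖, ‖D²P‖ ≤ A₂` at the point, `‖y‖ ≤ 1`, `|n₅| ≤ 1`, `‖n'‖ ≤ 1` and `‖n'‖² = 1 - n₅²`:
`|Φ''P - [Φ''n₅²P + 2Φ'n₅DP(n') + ΦD²P(n',n') - (1 - n₅²)ΦDP(y)] - H[Φ'n₅P + ΦDP(n')]|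
  ≤ A₁A₂(3(1 - n₅²) + 2‖n'‖ + 2|H|)`. [folklore] -/
theorem abs_productTestRemainder_le {Φ0 Φ1 Φ2 P0 n5 Hk A₁ A₂ : ℝ} {y n' : EuclideanSpace ℝ (Fin 5)} {P1 : EuclideanSpace ℝ (Fin 5) →L[ℝ] ℝ}
    {P2 : EuclideanSpace ℝ (Fin 5) [×2]→L[ℝ] ℝ}
    (hΦ0 : |Φ0| ≤ A₁) (hΦ1 : |Φ1| ≤ A₁) (hΦ2 : |Φ2| ≤ A₁)
    (hP0 : |P0| ≤ A₂) (hP1 : ‖P1‖ ≤ A₂) (hP2 : ‖P2‖ ≤ A₂)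
    (hy : ‖y‖ ≤ 1) (hn5 : |n5| ≤ 1) (hn'1 : ‖n'‖ ≤ 1) (hn'sq : ‖n'‖ ^ 2 = 1 - n5 ^ 2) :
    |Φ2 * P0 - (Φ2 * n5 ^ 2 * P0 + 2 * (Φ1 * n5 * P1 n') + Φ0 * P2 ![n', n']
        - (1 - n5 ^ 2) * (Φ0 * P1 y)) - Hk * (Φ1 * n5 * P0 + Φ0 * P1 n')|
      ≤ A₁ * A₂ * (3 * (1 - n5 ^ 2) + 2 * ‖n'‖ + 2 * |Hk|) := by
  have abs_mul_le_mul : ∀ {a b A B : ℝ}, |a| ≤ A → |b| ≤ B → |a * b| ≤ A * B :=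
    fun {a b A B} ha hb => by
      rw [abs_mul]
      exact mul_le_mul ha hb (abs_nonneg b) ((abs_nonneg a).trans ha)
  have hA₂ : 0 ≤ A₂ := (norm_nonneg _).trans hP1
  have h15 : 0 ≤ 1 - n5 ^ 2 := by rw [← hn'sq]; exact sq_nonneg _
  have h15' : |1 - n5 ^ 2| ≤ 1 - n5 ^ 2 := (abs_of_nonneg h15).le
  have e1 : |P1 n'| ≤ A₂ * ‖n'‖ := by
    rw [← Real.norm_eq_abs]; exact P1.le_of_opNorm_le hP1 n'
  have e1' : |P1 n'| ≤ A₂ := e1.trans (mul_le_of_le_one_right hA₂ hn'1)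
  have e2 : |P1 y| ≤ A₂ := by
    rw [← Real.norm_eq_abs]
    exact (P1.le_of_opNorm_le hP1 y).trans (mul_le_of_le_one_right hA₂ hy)
  have e3 : |P2 ![n', n']| ≤ A₂ * (1 - n5 ^ 2) := by
    rw [← Real.norm_eq_abs, ← hn'sq]
    refine (ContinuousMultilinearMap.le_of_opNorm_le hP2 _).trans (le_of_eq ?_)
    rw [Fin.prod_univ_two, sq]
    rfl
  have b1 := abs_le.1 (abs_mul_le_mul (abs_mul_le_mul hΦ2 hP0) h15')
  have b2 := abs_le.1 (abs_mul_le_mul (abs_mul_le_mul hΦ1 hn5) e1)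
  have b3 := abs_le.1 (abs_mul_le_mul hΦ0 e3)
  have b4 := abs_le.1 (abs_mul_le_mul h15' (abs_mul_le_mul hΦ0 e2))
  have b5 := abs_le.1 (abs_mul_le_mul (le_refl |Hk|) (abs_mul_le_mul (abs_mul_le_mul hΦ1 hn5) hP0))
  have b6 := abs_le.1 (abs_mul_le_mul (le_refl |Hk|) (abs_mul_le_mul hΦ0 e1'))
  rw [abs_le]
  constructor <;> linarith [b1.1, b1.2, b2.1, b2.2, b3.1, b3.2, b4.1, b4.2, b5.1, b5.2, b6.1, b6.2]

end Pointwise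

/-! ## Coordinates of points of `N` and of unit normals -/

section Coordinates

/-- `‖v‖² = ∑_{i<5} vᵢ² + v₅²` on `ℝ⁶`. [folklore] -/
theorem norm_sq_eq_sum_castSucc_add_sq (v : EuclideanSpace ℝ (Fin 6)) :
    ‖v‖ ^ 2 = (∑ i : Fin 5, v (Fin.castSucc i) ^ 2) + v 5 ^ 2 := by
  rw [EuclideanSpace.real_norm_sq_eq, Fin.sum_univ_castSucc]
  rfl

/-- `‖z'‖² = ∑_{i<5} zᵢ²` for `z' = truncL z`. [folklore] -/
theorem norm_truncL_sq (v : EuclideanSpace ℝ (Fin 6)) : ‖truncL v‖ ^ 2 = ∑ i : Fin 5, v (Fin.castSucc i) ^ 2 := by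
  rw [EuclideanSpace.real_norm_sq_eq]
  simp only [truncL_apply]

/-- On the slab `N ∩ {|z₅| ≤ B}`: `‖z‖ ≤ 1 + |B|` (`‖z‖² = 1 + z₅²`). [folklore] -/
theorem norm_le_one_add_abs {z : EuclideanSpace ℝ (Fin 6)} (hz : ∑ i : Fin 5, z (Fin.castSucc i) ^ 2 = 1) {B : ℝ}
    (hB : |z 5| ≤ B) : ‖z‖ ≤ 1 + |B| := by
  have hB0 : 0 ≤ |B| := abs_nonneg B
  have h3 : z 5 ^ 2 ≤ |B| ^ 2 := by
    rw [← sq_abs (z 5)]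
    exact pow_le_pow_left₀ (abs_nonneg _) (hB.trans (le_abs_self B)) 2
  have h4 : ‖z‖ ^ 2 ≤ (1 + |B|) ^ 2 := by
    rw [norm_sq_eq_sum_castSucc_add_sq, hz]
    nlinarith [h3, hB0]
  exact (sq_le_sq₀ (norm_nonneg _) (by positivity)).1 h4

variable {M : Type*} [TopologicalSpace M] [ChartedSpace (EuclideanSpace ℝ (Fin 4)) M] {f νf : M → EuclideanSpace ℝ (Fin 6)}

/-- A unit normal field has `‖ν‖ = 1`. [folklore] -/
theorem norm_normal_eq_one (hun : (euclideanMetric (EuclideanSpace ℝ (Fin 6))).IsUnitNormal (𝓡 4) f νf 1) (w : M) :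
    ‖νf w‖ = 1 := by
  have h : ⟪νf w, νf w⟫ = (1 : ℝ) := by
    have := hun.val_self w
    rwa [euclideanMetric_apply] at this
  rw [real_inner_self_eq_norm_sq] at h
  nlinarith [norm_nonneg (νf w)]

/-- `|ν'|² = ∑_{l<5} ν_l² = 1 - ν₅²` for a unit normal field. [folklore] -/
theorem sum_sq_castSucc_eq (hun : (euclideanMetric (EuclideanSpace ℝ (Fin 6))).IsUnitNormal (𝓡 4) f νf 1) (w : M) :
    ∑ l : Fin 5, νf w (Fin.castSucc l) ^ 2 = 1 - νf w 5 ^ 2 := by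
  have h := norm_sq_eq_sum_castSucc_add_sq (νf w)
  rw [norm_normal_eq_one hun w, one_pow] at h
  linarith

/-- `‖ν'‖² = 1 - ν₅²` for a unit normal field, `ν' = truncL ν`. [folklore] -/
theorem norm_truncL_normal_sq (hun : (euclideanMetric (EuclideanSpace ℝ (Fin 6))).IsUnitNormal (𝓡 4) f νf 1) (w : M) :
    ‖truncL (νf w)‖ ^ 2 = 1 - νf w 5 ^ 2 := by
  rw [norm_truncL_sq, sum_sq_castSucc_eq hun w]

/-- `|ν₅| ≤ 1` for a unit normal field. [folklore] -/
theorem abs_normal_five_le_one (hun : (euclideanMetric (EuclideanSpace ℝ (Fin 6))).IsUnitNormal (𝓡 4) f νf 1) (w : M) :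
    |νf w 5| ≤ 1 :=
  (sq_le_one_iff_abs_le_one _).1
    (by linarith [norm_truncL_normal_sq hun w, sq_nonneg ‖truncL (νf w)‖])

/-- `‖ν'‖ ≤ 1` for a unit normal field. [folklore] -/
theorem norm_truncL_normal_le_one (hun : (euclideanMetric (EuclideanSpace ℝ (Fin 6))).IsUnitNormal (𝓡 4) f νf 1) (w : M) :
    ‖truncL (νf w)‖ ≤ 1 :=
  (sq_le_one_iff₀ (norm_nonneg _)).1
    (by linarith [norm_truncL_normal_sq hun w, sq_nonneg (νf w 5)])

end Coordinates

/-! ## Compactness bounds, continuity and measure bookkeeping -/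

section Bookkeeping

/-- Three continuous functions are bounded by one nonnegative constant on a compact set.
[folklore] -/
theorem exists_common_bound {X E₁ E₂ E₃ : Type*} [TopologicalSpace X] [SeminormedAddCommGroup E₁]
    [SeminormedAddCommGroup E₂] [SeminormedAddCommGroup E₃] {K : Set X} (hK : IsCompact K)
    {f : X → E₁} {g : X → E₂} {h : X → E₃} (hf : Continuous f) (hg : Continuous g)
    (hh : Continuous h) :
    ∃ C : ℝ, 0 ≤ C ∧ ∀ x ∈ K, ‖f x‖ ≤ C ∧ ‖g x‖ ≤ C ∧ ‖h x‖ ≤ C := by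
  obtain ⟨C₁, h₁⟩ := hK.exists_bound_of_continuousOn hf.continuousOn
  obtain ⟨C₂, h₂⟩ := hK.exists_bound_of_continuousOn hg.continuousOn
  obtain ⟨C₃, h₃⟩ := hK.exists_bound_of_continuousOn hh.continuousOn
  refine ⟨max (max C₁ C₂) (max C₃ 0), le_max_of_le_right (le_max_right _ _), fun x hx => ⟨?_, ?_, ?_⟩⟩
  · exact (h₁ x hx).trans (le_max_of_le_left (le_max_left _ _))
  · exact (h₂ x hx).trans (le_max_of_le_left (le_max_right _ _))
  · exact (h₃ x hx).trans (le_max_of_le_right (le_max_left _ _))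

/-- The second derivative of a `C²` function of one variable is continuous. [folklore] -/
theorem continuous_deriv_deriv {Φ : ℝ → ℝ} (hΦ : ContDiff ℝ 2 Φ) : Continuous (deriv (deriv Φ)) := by
  have h : ContDiff ℝ (1 + 1) Φ := hΦ
  exact (contDiff_succ_iff_deriv.1 h).2.2.continuous_deriv le_rfl

/-- `x ↦ DP_{g x}(a x)` is continuous for `P ∈ C²` and `g, a` continuous. [folklore] -/
theorem continuous_fderiv_app {X : Type*} [TopologicalSpace X] {P : EuclideanSpace ℝ (Fin 5) → ℝ} (hP : ContDiff ℝ 2 P)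
    {g a : X → EuclideanSpace ℝ (Fin 5)} (hg : Continuous g) (ha : Continuous a) :
    Continuous fun x => fderiv ℝ P (g x) (a x) :=
  ((hP.continuous_fderiv two_ne_zero).comp hg).clm_apply ha

/-- `x ↦ D²P_{g x}(a x, b x)` is continuous for `P ∈ C²` and `g, a, b` continuous. [folklore] -/
theorem continuous_iteratedFDeriv_two_app {X : Type*} [TopologicalSpace X] {P : EuclideanSpace ℝ (Fin 5) → ℝ}
    (hP : ContDiff ℝ 2 P) {g a b : X → EuclideanSpace ℝ (Fin 5)} (hg : Continuous g) (ha : Continuous a)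
    (hb : Continuous b) :
    Continuous fun x => iteratedFDeriv ℝ 2 P (g x) ![a x, b x] :=
  ((hP.continuous_iteratedFDeriv (m := 2) le_rfl).comp hg).eval
    (ha.matrixVecCons (hb.matrixVecCons continuous_const))

end Bookkeeping

/-! ## The single-slice estimate -/

section Slice

variable {M : Type*} [TopologicalSpace M] [ChartedSpace (EuclideanSpace ℝ (Fin 4)) M]
  [IsManifold (𝓡 4) ∞ M] [CompactSpace M] [T2Space M] [MeasurableSpace M] [BorelSpace M]

/-- **Single-slice estimate.** For a closed immersed cross-section `f : M⁴ → N` with smooth unit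
normal `ν` tangent to `N`, heights in `[-B, B]`, `Φ ∈ C²(ℝ)` with `|Φ|, |Φ'|, |Φ''| ≤ A₁` on
`[-B, B]`, `P ∈ C²(ℝ⁵)` with `|P|, ‖DP‖, ‖D²P‖ ≤ A₂` on the closed unit ball, and
`F(z) = Φ(z₅)[Δ_{ℝ⁵}P(z') - D²P(z')(z',z') - 4DP(z')(z')]`:
`|∫_M F ∘ f dμ_g| ≤ A₁A₂ (3 T + 2 √(μ_g(M) T) + 2 √(μ_g(M) ∫ H² dμ_g))`, `T = ∫_M (1 - ν₅²) dμ_g`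
(the product test identity `∫ (F ∘ f + R) dμ_g = 0`, the pointwise bound
`|R| ≤ A₁A₂(3(1 - ν₅²) + 2‖ν'‖ + 2|H|)` and Cauchy–Schwarz). [cite: Hamilton1993, §4] -/
theorem abs_integral_productTest_comp_le {f νf : M → EuclideanSpace ℝ (Fin 6)}
    (hf : (euclideanMetric (EuclideanSpace ℝ (Fin 6))).IsSpacelikeImmersion (𝓡 4) f)
    (hν : ContMDiff (𝓡 4) 𝓘(ℝ, EuclideanSpace ℝ (Fin 6)) ∞ νf)
    (hun : (euclideanMetric (EuclideanSpace ℝ (Fin 6))).IsUnitNormal (𝓡 4) f νf 1)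
    (hN : ∀ x, ∑ i : Fin 5, f x (Fin.castSucc i) ^ 2 = 1)
    (hνN : ∀ x, ∑ i : Fin 5, νf x (Fin.castSucc i) * f x (Fin.castSucc i) = 0)
    {B : ℝ} (hB : ∀ x, |f x 5| ≤ B)
    {Φ : ℝ → ℝ} (hΦ : ContDiff ℝ 2 Φ) {P : EuclideanSpace ℝ (Fin 5) → ℝ} (hP : ContDiff ℝ 2 P)
    {A₁ A₂ : ℝ} (hA₁ : 0 ≤ A₁) (hA₂ : 0 ≤ A₂)
    (hΦb : ∀ s ∈ Icc (-B) B, ‖Φ s‖ ≤ A₁ ∧ ‖deriv Φ s‖ ≤ A₁ ∧ ‖deriv (deriv Φ) s‖ ≤ A₁)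
    (hPb : ∀ y ∈ Metric.closedBall (0 : EuclideanSpace ℝ (Fin 5)) 1,
      ‖P y‖ ≤ A₂ ∧ ‖fderiv ℝ P y‖ ≤ A₂ ∧ ‖iteratedFDeriv ℝ 2 P y‖ ≤ A₂)
    {F : EuclideanSpace ℝ (Fin 6) → ℝ} (hFc : Continuous F)
    (hF : ∀ z, F z = Φ (z 5) *
      ((∑ j : Fin 5, iteratedFDeriv ℝ 2 P (truncL z)
          ![EuclideanSpace.single j (1 : ℝ), EuclideanSpace.single j (1 : ℝ)])
        - iteratedFDeriv ℝ 2 P (truncL z) ![truncL z, truncL z]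
        - 4 * fderiv ℝ P (truncL z) (truncL z))) :
    |∫ w, F (f w) ∂riemannianMeasure ((euclideanMetric (EuclideanSpace ℝ (Fin 6))).inducedRiemannianMetric f
        contMDiff_pullbackBilin_holds hf)| ≤
      A₁ * A₂ * (3 * ∫ w, (1 - νf w 5 ^ 2) ∂riemannianMeasure ((euclideanMetric (EuclideanSpace ℝ (Fin 6))).inducedRiemannianMetric f
            contMDiff_pullbackBilin_holds hf)
        + 2 * Real.sqrt ((riemannianMeasure ((euclideanMetric (EuclideanSpace ℝ (Fin 6))).inducedRiemannianMetric f
            contMDiff_pullbackBilin_holds hf) univ).toReal *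
            ∫ w, (1 - νf w 5 ^ 2) ∂riemannianMeasure ((euclideanMetric (EuclideanSpace ℝ (Fin 6))).inducedRiemannianMetric f
              contMDiff_pullbackBilin_holds hf))
        + 2 * Real.sqrt ((riemannianMeasure ((euclideanMetric (EuclideanSpace ℝ (Fin 6))).inducedRiemannianMetric f
            contMDiff_pullbackBilin_holds hf) univ).toReal *
            ∫ w, (euclideanMetric (EuclideanSpace ℝ (Fin 6))).meanCurvature f contMDiff_pullbackBilin_holds hf νf w ^ 2
              ∂riemannianMeasure ((euclideanMetric (EuclideanSpace ℝ (Fin 6))).inducedRiemannianMetric f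
                contMDiff_pullbackBilin_holds hf))) := by
  set g₁ := (euclideanMetric (EuclideanSpace ℝ (Fin 6))).inducedRiemannianMetric f contMDiff_pullbackBilin_holds hf
  set Hm : M → ℝ := fun w => (euclideanMetric (EuclideanSpace ℝ (Fin 6))).meanCurvature f contMDiff_pullbackBilin_holds hf νf w
  haveI : IsFiniteMeasure (riemannianMeasure g₁) := isFiniteMeasure_riemannianMeasure g₁
  -- the product test identity
  have h0 := productTest_identity hf hν hun hN hνN hΦ hP
  -- the remainder
  obtain ⟨R, hR⟩ : ∃ R : M → ℝ, ∀ w, R w =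
      deriv (deriv Φ) (f w 5) * P (truncL (f w))
        - (deriv (deriv Φ) (f w 5) * νf w 5 ^ 2 * P (truncL (f w))
            + 2 * (deriv Φ (f w 5) * νf w 5 * fderiv ℝ P (truncL (f w)) (truncL (νf w)))
            + Φ (f w 5) * iteratedFDeriv ℝ 2 P (truncL (f w)) ![truncL (νf w), truncL (νf w)]
            - (∑ l : Fin 5, νf w (Fin.castSucc l) ^ 2)
                * (Φ (f w 5) * fderiv ℝ P (truncL (f w)) (truncL (f w))))
        - Hm w * (deriv Φ (f w 5) * νf w 5 * P (truncL (f w))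
            + Φ (f w 5) * fderiv ℝ P (truncL (f w)) (truncL (νf w))) := ⟨_, fun w => rfl⟩
  -- the integrand of the identity is `F ∘ f + R`, pointwise
  have hsplit : ∀ w,
      ((deriv (deriv Φ) (f w 5) * P (truncL (f w))
            + Φ (f w 5) * (∑ j : Fin 5, iteratedFDeriv ℝ 2 P (truncL (f w))
                ![EuclideanSpace.single j (1 : ℝ), EuclideanSpace.single j (1 : ℝ)])
            - Φ (f w 5) * iteratedFDeriv ℝ 2 P (truncL (f w)) ![truncL (f w), truncL (f w)]
            - 4 * (Φ (f w 5) * fderiv ℝ P (truncL (f w)) (truncL (f w))))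
        - (deriv (deriv Φ) (f w 5) * νf w 5 ^ 2 * P (truncL (f w))
            + 2 * (deriv Φ (f w 5) * νf w 5 * fderiv ℝ P (truncL (f w)) (truncL (νf w)))
            + Φ (f w 5) * iteratedFDeriv ℝ 2 P (truncL (f w)) ![truncL (νf w), truncL (νf w)]
            - (∑ l : Fin 5, νf w (Fin.castSucc l) ^ 2)
                * (Φ (f w 5) * fderiv ℝ P (truncL (f w)) (truncL (f w))))
        - Hm w * (deriv Φ (f w 5) * νf w 5 * P (truncL (f w))
              + Φ (f w 5) * fderiv ℝ P (truncL (f w)) (truncL (νf w))))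
        = F (f w) + R w := fun w => by
    rw [hF, hR]
    ring
  have h1 : ∫ w, (F (f w) + R w) ∂riemannianMeasure g₁ = 0 :=
    (integral_congr_ae (Eventually.of_forall fun w => (hsplit w).symm)).trans h0
  -- continuity and integrability
  have hfc : Continuous f := hf.contMDiff_self.continuous
  have hνc : Continuous νf := hν.continuous
  have h5 : Continuous fun z : EuclideanSpace ℝ (Fin 6) => z 5 :=
    (EuclideanSpace.proj (5 : Fin 6) : EuclideanSpace ℝ (Fin 6) →L[ℝ] ℝ).continuous
  have hHc : Continuous Hm := continuous_meanCurvature_euclidean hf hν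
  have cΦ0 : Continuous fun w => Φ (f w 5) := hΦ.continuous.comp (h5.comp hfc)
  have cΦ1 : Continuous fun w => deriv Φ (f w 5) :=
    (hΦ.continuous_deriv (by norm_num)).comp (h5.comp hfc)
  have cΦ2 : Continuous fun w => deriv (deriv Φ) (f w 5) :=
    (continuous_deriv_deriv hΦ).comp (h5.comp hfc)
  have ctf : Continuous fun w => truncL (f w) := truncL.continuous.comp hfc
  have ctν : Continuous fun w => truncL (νf w) := truncL.continuous.comp hνc
  have cP0 : Continuous fun w => P (truncL (f w)) := hP.continuous.comp ctf
  have cν5 : Continuous fun w => νf w 5 := h5.comp hνc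
  have cDPν := continuous_fderiv_app hP ctf ctν
  have cDPz := continuous_fderiv_app hP ctf ctf
  have cD2P := continuous_iteratedFDeriv_two_app hP ctf ctν ctν
  have cS : Continuous fun w => ∑ l : Fin 5, νf w (Fin.castSucc l) ^ 2 :=
    continuous_finsetSum _ fun l _ =>
      ((EuclideanSpace.proj (Fin.castSucc l) : EuclideanSpace ℝ (Fin 6) →L[ℝ] ℝ).continuous.comp hνc).pow 2
  have hRc : Continuous R := by
    rw [funext hR]
    exact ((cΦ2.mul cP0).sub (((((cΦ2.mul (cν5.pow 2)).mul cP0).add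
      (continuous_const.mul ((cΦ1.mul cν5).mul cDPν))).add (cΦ0.mul cD2P)).sub
        (cS.mul (cΦ0.mul cDPz)))).sub (hHc.mul (((cΦ1.mul cν5).mul cP0).add (cΦ0.mul cDPν)))
  have hFi : Integrable (fun w => F (f w)) (riemannianMeasure g₁) :=
    integrable_of_continuous (h := g₁) (hFc.comp hfc)
  have hRi : Integrable R (riemannianMeasure g₁) := integrable_of_continuous (h := g₁) hRc
  have h2 : ∫ w, F (f w) ∂riemannianMeasure g₁ = -∫ w, R w ∂riemannianMeasure g₁ := by
    rw [integral_add hFi hRi] at h1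
    linarith
  -- the pointwise bound on the remainder
  have hRle : ∀ w, |R w| ≤ A₁ * A₂ * (3 * (1 - νf w 5 ^ 2) + 2 * ‖truncL (νf w)‖ + 2 * |Hm w|) :=
    fun w => by
      obtain ⟨hΦ0, hΦ1, hΦ2⟩ := hΦb (f w 5) (by rw [mem_Icc, ← abs_le]; exact hB w)
      have hy1 : ‖truncL (f w)‖ ≤ 1 :=
        (sq_le_one_iff₀ (norm_nonneg _)).1 (le_of_eq (by rw [norm_truncL_sq, hN w]))
      obtain ⟨hP0, hP1, hP2⟩ := hPb (truncL (f w)) (mem_closedBall_zero_iff.2 hy1)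
      rw [Real.norm_eq_abs] at hΦ0 hΦ1 hΦ2 hP0
      rw [hR, sum_sq_castSucc_eq hun w]
      exact abs_productTestRemainder_le hΦ0 hΦ1 hΦ2 hP0 hP1 hP2 hy1
        (abs_normal_five_le_one hun w) (norm_truncL_normal_le_one hun w)
        (norm_truncL_normal_sq hun w)
  -- integrate it
  have hTc : Continuous fun w => 1 - νf w 5 ^ 2 := continuous_const.sub (cν5.pow 2)
  have hnc : Continuous fun w => ‖truncL (νf w)‖ := ctν.norm
  have h3T : Integrable (fun w => 3 * (1 - νf w 5 ^ 2)) (riemannianMeasure g₁) :=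
    integrable_of_continuous (h := g₁) (continuous_const.mul hTc)
  have h2n : Integrable (fun w => 2 * ‖truncL (νf w)‖) (riemannianMeasure g₁) :=
    integrable_of_continuous (h := g₁) (continuous_const.mul hnc)
  have h2H : Integrable (fun w => 2 * |Hm w|) (riemannianMeasure g₁) :=
    integrable_of_continuous (h := g₁) (continuous_const.mul hHc.abs)
  have hbi : Integrable (fun w => A₁ * A₂ * (3 * (1 - νf w 5 ^ 2) + 2 * ‖truncL (νf w)‖ + 2 * |Hm w|))
      (riemannianMeasure g₁) :=
    integrable_of_continuous (h := g₁) (continuous_const.mul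
      (((continuous_const.mul hTc).add (continuous_const.mul hnc)).add
        (continuous_const.mul hHc.abs)))
  have h3 : ∫ w, |R w| ∂riemannianMeasure g₁ ≤
      A₁ * A₂ * (3 * ∫ w, (1 - νf w 5 ^ 2) ∂riemannianMeasure g₁
        + 2 * ∫ w, ‖truncL (νf w)‖ ∂riemannianMeasure g₁ + 2 * ∫ w, |Hm w| ∂riemannianMeasure g₁) := by
    have := integral_mono hRi.abs hbi hRle
    rw [integral_const_mul, integral_add (h3T.fun_add h2n) h2H, integral_add h3T h2n, integral_const_mul,
      integral_const_mul, integral_const_mul] at this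
    exact this
  -- Cauchy–Schwarz
  have h4 : ∫ w, ‖truncL (νf w)‖ ∂riemannianMeasure g₁ ≤
      Real.sqrt ((riemannianMeasure g₁ univ).toReal * ∫ w, (1 - νf w 5 ^ 2) ∂riemannianMeasure g₁) := by
    have := integral_abs_le_sqrt_measure_mul_integral_sq (riemannianMeasure g₁)
      hnc.aestronglyMeasurable (integrable_of_continuous (h := g₁) (hnc.pow 2))
    simp_rw [abs_norm, norm_truncL_normal_sq hun] at this
    exact this
  have h6 : ∫ w, |Hm w| ∂riemannianMeasure g₁ ≤
      Real.sqrt ((riemannianMeasure g₁ univ).toReal * ∫ w, Hm w ^ 2 ∂riemannianMeasure g₁) :=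
    integral_abs_le_sqrt_measure_mul_integral_sq _ hHc.aestronglyMeasurable
      (integrable_of_continuous (h := g₁) (hHc.pow 2))
  -- assemble
  rw [h2, abs_neg]
  calc |∫ w, R w ∂riemannianMeasure g₁| ≤ ∫ w, |R w| ∂riemannianMeasure g₁ :=
        abs_integral_le_integral_abs
    _ ≤ A₁ * A₂ * (3 * ∫ w, (1 - νf w 5 ^ 2) ∂riemannianMeasure g₁
        + 2 * ∫ w, ‖truncL (νf w)‖ ∂riemannianMeasure g₁ + 2 * ∫ w, |Hm w| ∂riemannianMeasure g₁) := h3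
    _ ≤ A₁ * A₂ * (3 * ∫ w, (1 - νf w 5 ^ 2) ∂riemannianMeasure g₁
        + 2 * Real.sqrt ((riemannianMeasure g₁ univ).toReal *
            ∫ w, (1 - νf w 5 ^ 2) ∂riemannianMeasure g₁)
        + 2 * Real.sqrt ((riemannianMeasure g₁ univ).toReal *
            ∫ w, Hm w ^ 2 ∂riemannianMeasure g₁)) := by
        refine mul_le_mul_of_nonneg_left ?_ (mul_nonneg hA₁ hA₂)
        linarith

end Slice

/-- **Registered sub-goal `helper_productTestLimit_part1` (part 1/2 of `helper_productTestLimit`):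
the single-slice estimate `abs_integral_productTest_comp_le`, verbatim with explicit binders.**
For a closed immersed cross-section `f : M⁴ → N` with smooth unit normal `ν` tangent to `N`,
heights in `[-B, B]`, `|Φ|, |Φ'|, |Φ''| ≤ A₁` on `[-B, B]`, `|P|, ‖DP‖, ‖D²P‖ ≤ A₂` on the closed
unit ball and `F(z) = Φ(z₅)[Δ_{ℝ⁵}P(z') - D²P(z')(z',z') - 4DP(z')(z')]`:
`|∫_M F ∘ f dμ_g| ≤ A₁A₂ (3 T + 2 √(μ_g(M) T) + 2 √(μ_g(M) ∫ H² dμ_g))`, `T = ∫_M (1 - ν₅²) dμ_g`.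
[cite: Hamilton1993, §4] -/
theorem helper_productTestLimit_part1 : ∀ (M : Type) [TopologicalSpace M] [ChartedSpace (EuclideanSpace ℝ (Fin 4)) M] [IsManifold (𝓡 4) ∞ M] [CompactSpace M] [T2Space M] [MeasurableSpace M] [BorelSpace M] (f νf : M → EuclideanSpace ℝ (Fin 6)) (hf : (Literature.Geometry.Riemannian.euclideanMetric (EuclideanSpace ℝ (Fin 6))).IsSpacelikeImmersion (𝓡 4) f), ContMDiff (𝓡 4) (𝓡 6) ∞ νf → (Literature.Geometry.Riemannian.euclideanMetric (EuclideanSpace ℝ (Fin 6))).IsUnitNormal (𝓡 4) f νf 1 → (∀ x, ∑ i : Fin 5, f x (Fin.castSucc i) ^ 2 = 1) → (∀ x, ∑ i : Fin 5, νf x (Fin.castSucc i) * f x (Fin.castSucc i) = 0) → ∀ B : ℝ, (∀ x, |f x 5| ≤ B) → ∀ Φ : ℝ → ℝ, ContDiff ℝ 2 Φ → ∀ P : EuclideanSpace ℝ (Fin 5) → ℝ, ContDiff ℝ 2 P → ∀ A₁ A₂ : ℝ, 0 ≤ A₁ → 0 ≤ A₂ → (∀ s ∈ Set.Icc (-B)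 B, ‖Φ s‖ ≤ A₁ ∧ ‖deriv Φ s‖ ≤ A₁ ∧ ‖deriv (deriv Φ) s‖ ≤ A₁) → (∀ y ∈ Metric.closedBall (0 : EuclideanSpace ℝ (Fin 5)) 1, ‖P y‖ ≤ A₂ ∧ ‖fderiv ℝ P y‖ ≤ A₂ ∧ ‖iteratedFDeriv ℝ 2 P y‖ ≤ A₂) → ∀ F : EuclideanSpace ℝ (Fin 6) → ℝ, Continuous F → (∀ z, F z = Φ (z 5) * ((∑ j : Fin 5, iteratedFDeriv ℝ 2 P (Literature.Geometry.Riemannian.SphericalCylinderEntropy.truncL z) ![EuclideanSpace.single j (1 : ℝ), EuclideanSpace.single j (1 : ℝ)]) - iteratedFDeriv ℝ 2 P (Literature.Geometry.Riemannian.SphericalCylinderEntropy.truncL z) ![Literature.Geometry.Riemannian.SphericalCylinderEntropy.truncL z, Literature.Geometry.Riemannian.SphericalCylinderEntropy.truncL z] - 4 * fderiv ℝ P (Literature.Geometry.Riemannian.SphericalCylinderEntropy.truncL z) (Literature.Geometry.Riemannian.SphericalCylinderEntropy.truncL z))) → |∫ w, F (f w) ∂Literature.Geometry.Lorentzian.riemannianMeasure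 ((Literature.Geometry.Riemannian.euclideanMetric (EuclideanSpace ℝ (Fin 6))).inducedRiemannianMetric f Literature.Geometry.Lorentzian.PseudoRiemannianMetric.contMDiff_pullbackBilin_holds hf)| ≤ A₁ * A₂ * (3 * ∫ w, (1 - νf w 5 ^ 2) ∂Literature.Geometry.Lorentzian.riemannianMeasure ((Literature.Geometry.Riemannian.euclideanMetric (EuclideanSpace ℝ (Fin 6))).inducedRiemannianMetric f Literature.Geometry.Lorentzian.PseudoRiemannianMetric.contMDiff_pullbackBilin_holds hf) + 2 * Real.sqrt ((Literature.Geometry.Lorentzian.riemannianMeasure ((Literature.Geometry.Riemannian.euclideanMetric (EuclideanSpace ℝ (Fin 6))).inducedRiemannianMetric f Literature.Geometry.Lorentzian.PseudoRiemannianMetric.contMDiff_pullbackBilin_holds hf) Set.univ).toReal * ∫ w, (1 - νf w 5 ^ 2) ∂Literature.Geometry.Lorentzian.riemannianMeasure ((Literature.Geometry.Riemannian.euclideanMetric (EuclideanSpace ℝ (Fin 6))).inducedRiemannianMetric f Literature.Geometry.Lorentzian.PseudoRiemannianMetric.contMDiff_pullbackBilin_holds hf)) + 2 * Real.sqrt ((Literature.Geometry.Lorentzian.riemannianMeasure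 ((Literature.Geometry.Riemannian.euclideanMetric (EuclideanSpace ℝ (Fin 6))).inducedRiemannianMetric f Literature.Geometry.Lorentzian.PseudoRiemannianMetric.contMDiff_pullbackBilin_holds hf) Set.univ).toReal * ∫ w, (Literature.Geometry.Riemannian.euclideanMetric (EuclideanSpace ℝ (Fin 6))).meanCurvature f Literature.Geometry.Lorentzian.PseudoRiemannianMetric.contMDiff_pullbackBilin_holds hf νf w ^ 2 ∂Literature.Geometry.Lorentzian.riemannianMeasure ((Literature.Geometry.Riemannian.euclideanMetric (EuclideanSpace ℝ (Fin 6))).inducedRiemannianMetric f Literature.Geometry.Lorentzian.PseudoRiemannianMetric.contMDiff_pullbackBilin_holds hf))) :=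
  fun _ _ _ _ _ _ _ _ _ _ hf hν hun hN hνN _ hB _ hΦ _ hP _ _ hA₁ hA₂ hΦb hPb _ hFc hF =>
    abs_integral_productTest_comp_le hf hν hun hN hνN hB hΦ hP hA₁ hA₂ hΦb hPb hFc hF

end Summit.SmoothPoincare4.SmoothPoincare4.Cruxes.CylinderRungTwo.KillingFlux

end
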